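import Literature.Barriers.Parity.SiegelZeroDichotomyPairHLTypeIExpansion
import Literature.Barriers.Parity.SiegelZeroDichotomyPairHLProp71Smooth
import Literature.Barriers.Parity.SiegelZeroDichotomyChowlaStep3Cutoff
import Literature.NumberTheory.LFunctions.LargeValuesFourierDecay
import Mathlib.Analysis.Calculus.ContDiff.Convolution
import Mathlib.Analysis.Fourier.Inversion
import Mathlib.Analysis.Fourier.FourierTransformDeriv
import Mathlib.Analysis.SpecialFunctions.JapaneseBracket
import Mathlib.MeasureTheory.Measure.Haar.NormedSpace
import HarnessLib

/-!
# Tao–Teräväinen 2022, Lemma 8.2 (`k = 2`): the weight `Ψ` as a smooth function of `log`, and its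
# Fourier representation

Topic `Literature/Barriers/Parity`, sub-namespace `TaoTeravainen`; part of step (v) of the proof
DAG of `Literature.Barriers.Parity.TaoTeravainen2021_prop72_81_pair` (T. Tao, J. Teräväinen, *The
Hardy–Littlewood–Chowla conjecture in the presence of a Siegel zero*, J. London Math. Soc. (2) 106
(2022), arXiv:2109.06291), Lemma 8.2 (Fourier expansion): "`Φ((y+h_j)/d) = log x ∫_ℝ d^{-(1+it)/log x}
F_j(t) dt` for all real `d ≥ 1`, and some measurable `F_j` obeying `F_j(t) ≪_m (1+|t|)^{-m}` … as
well as `∫_ℝ F_j(t)(1+it) dt = 1`. … from (8.3) we have `Φ((y+h_j)/d) = ∫₀^∞ ψ(log(x/t)/(2 log Dq²))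
Φ_{dt}(y+h_j) log t dt/t` … which on making the change of variables … factors … from integration by
parts one has `∫ e^{(1+it)s} ψ(log x s/(2 log Dq²))(1−s) ds ≪_m (1+|t|)^{-m}`."
Everything here is PROVED, in the variables `u = log t`, `X = log x`, `U₀ = log(Dq²)` of
`SiegelZeroDichotomyPairHLTypeIExpansion.lean`. This first file treats the weight as a smooth
function of `w = log y`:

* `sharpW ψ X U₀ u = ψ((X-u)/(2U₀)) u` (smooth, supported in `[X-2U₀, X+2U₀]`) and its iterated
  derivatives (`abs_iteratedDeriv_sharpW_le`: `≪_n (2U₀)^{-n} (X + 2U₀)`-type bounds);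
* `psiLog φ ψ X U₀ = sharpW ⋆ φ` with `psiSharp φ ψ X U₀ (exp w) = psiLog w` once `3U₀ ≤ X`
  (`psiSharp_exp_eq_psiLog`; the restriction `u > U₀` in `Ψ` is then automatic), smooth, supported in
  `[X-2U₀-1, X+2U₀+1]`, with `iteratedDeriv n psiLog = (iteratedDeriv n sharpW) ⋆ φ` and the bounds
  `|psiLog⁽ⁿ⁾| ≤ sup|sharpW⁽ⁿ⁾|`;
* `psiTwist` (`g_c(v) = e^{v/X} psiLog(c - v)`, `v = log d`, `c = log(y+h)`), `psiFourier = 𝓕 g_c`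
  (the source's `F_j`, our normalisation): decay on the scale `1/U₀` (`psiFourier_decay`:
  `(1 + U₀|τ|)ⁿ‖ĝ_c(τ)‖ ≤ 2ⁿ6e U₀ (1+n)(X+2U₀) S_n`), integrability, the representation
  `Ψ(e^{c-v}) = e^{-v/X} ∫ e^{2πiτv} ĝ_c(τ) dτ` (`psiSharp_exp_sub_eq_integral`, Fourier inversion) and
  **`∫ ĝ_c(τ)(1/X - 2πiτ) dτ = 1`** (`integral_psiFourier_mul_eq_one`, valid when `Ψ(e^w) = w` near `c`);
* the sieve slots: `sieveProfile` (`e^u ψ(u)`), `sieveFourier = 𝓕` of it (the source's `f`), decay to all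
  orders, `ψ(u) = e^{-u} ∫ e^{2πiτu} f(τ) dτ` (`cutoff_eq_integral`) and `∫ f = 1` (`integral_sieveFourier`).
  [cite: TaoTeravainen2021, Lemma 8.2 and its proof]
-/

noncomputable section

open Real MeasureTheory Set Filter Complex
open scoped ContDiff Topology Convolution FourierTransform
open Literature.NumberTheory.LFunctions.GuthMaynardFourier (hasCompactSupport_iteratedDeriv
  norm_fourier_le_integral_norm norm_fourier_le_of_iteratedDeriv integral_norm_le_of_bound_Icc)

namespace Literature.Barriers.Parity

namespace TaoTeravainen

/-! ### Generic: bounded iterated derivatives of a smooth compactly supported function -/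

/-- A `C^∞` function with compact support has bounded iterated derivatives. [folklore] -/
theorem exists_bound_iteratedDeriv_of_hasCompactSupport {f : ℝ → ℝ} (hf : ContDiff ℝ ∞ f)
    (hfc : HasCompactSupport f) (n : ℕ) : ∃ M : ℝ, 0 ≤ M ∧ ∀ x, |iteratedDeriv n f x| ≤ M := by
  have hc : Continuous (iteratedDeriv n f) := hf.continuous_iteratedDeriv n (by exact_mod_cast le_top)
  have hs : HasCompactSupport (iteratedDeriv n f) := by
    induction n with
    | zero => simpa [iteratedDeriv_zero] using hfc
    | succ n ih => rw [iteratedDeriv_succ]; exact ih (hf.continuous_iteratedDeriv n (by exact_mod_cast le_top)) |>.deriv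
  obtain ⟨C, hC⟩ := hc.bounded_above_of_compact_support hs
  refine ⟨max C 0, le_max_right _ _, fun x => ?_⟩
  have := hC x
  rw [Real.norm_eq_abs] at this
  exact this.trans (le_max_left _ _)

/-- The cutoff `ψ` has bounded iterated derivatives of every order. [folklore] -/
theorem IsSmoothCutoff.exists_bound_iteratedDeriv' {ψ : ℝ → ℝ} (hψ : IsSmoothCutoff ψ) (n : ℕ) :
    ∃ M : ℝ, 0 ≤ M ∧ ∀ x, |iteratedDeriv n ψ x| ≤ M := by
  refine exists_bound_iteratedDeriv_of_hasCompactSupport hψ.contDiff ?_ n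
  refine HasCompactSupport.of_support_subset_isCompact (isCompact_Icc (a := (-1 : ℝ)) (b := 1)) fun u hu => ?_
  rw [Function.mem_support] at hu
  rw [Set.mem_Icc]
  by_contra h
  rw [not_and_or, not_le, not_le] at h
  exact hu (hψ.eq_zero u (by rcases h with h | h <;> [rw [abs_of_neg (by linarith)]; rw [abs_of_pos (by linarith)]] <;> linarith))

/-- `tsupport ψ ⊆ [-1, 1]`. [folklore] -/
theorem IsSmoothCutoff.tsupport_subset {ψ : ℝ → ℝ} (hψ : IsSmoothCutoff ψ) : tsupport ψ ⊆ Set.Icc (-1) 1 := by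
  refine closure_minimal (fun u hu => ?_) isClosed_Icc
  rw [Function.mem_support] at hu
  rw [Set.mem_Icc]
  by_contra h
  rw [not_and_or, not_le, not_le] at h
  exact hu (hψ.eq_zero u (by rcases h with h | h <;> [rw [abs_of_neg (by linarith)]; rw [abs_of_pos (by linarith)]] <;> linarith))

/-- Iterated derivatives of `ψ` vanish off `(-1, 1)`… more precisely off `[-1,1]`'s complement
closure: for `1 < |z|`, `iteratedDeriv n ψ z = 0`. [folklore] -/
theorem IsSmoothCutoff.iteratedDeriv_eq_zero {ψ : ℝ → ℝ} (hψ : IsSmoothCutoff ψ) (n : ℕ) {z : ℝ}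
    (hz : 1 < |z|) : iteratedDeriv n ψ z = 0 := by
  refine iteratedDeriv_eq_zero_of_notMem_tsupport_real (fun h => ?_) n
  have := hψ.tsupport_subset h
  rw [Set.mem_Icc] at this
  have : |z| ≤ 1 := abs_le.mpr ⟨this.1, this.2⟩
  linarith

/-! ### The weight `W(u) = ψ((X-u)/(2U₀)) u` -/

/-- `W(u) := w♯(u) u = ψ((X-u)/(2U₀)) u`. [cite: TaoTeravainen2021, proof of Lemma 8.2 (the factor
`ψ(log x s/(2 log Dq²))(1-s)`)] -/
def sharpW (ψ : ℝ → ℝ) (X U₀ u : ℝ) : ℝ := sharpWeight ψ X U₀ u * u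

/-- `w♯` as a composition with an affine map. [folklore] -/
theorem sharpWeight_eq_comp (ψ : ℝ → ℝ) (X U₀ : ℝ) :
    sharpWeight ψ X U₀ = fun u => (fun z => ψ (z + X / (2 * U₀))) ((-1 / (2 * U₀)) * u) := by
  ext u; unfold sharpWeight; congr 1; ring

/-- `w♯` is smooth. [folklore] -/
theorem contDiff_sharpWeight {ψ : ℝ → ℝ} (hψ : IsSmoothCutoff ψ) (X U₀ : ℝ) :
    ContDiff ℝ ∞ (sharpWeight ψ X U₀) := by
  rw [sharpWeight_eq_comp]
  exact (hψ.contDiff.comp (contDiff_id.add contDiff_const)).comp (contDiff_const.mul contDiff_id)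

/-- `W` is smooth. [folklore] -/
theorem contDiff_sharpW {ψ : ℝ → ℝ} (hψ : IsSmoothCutoff ψ) (X U₀ : ℝ) : ContDiff ℝ ∞ (sharpW ψ X U₀) :=
  (contDiff_sharpWeight hψ X U₀).mul contDiff_id

/-- The iterated derivatives of `w♯`: `(w♯)⁽ⁿ⁾(u) = (-1/(2U₀))ⁿ ψ⁽ⁿ⁾((X-u)/(2U₀))`. [folklore] -/
theorem iteratedDeriv_sharpWeight {ψ : ℝ → ℝ} (hψ : IsSmoothCutoff ψ) (X U₀ : ℝ) (n : ℕ) (u : ℝ) :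
    iteratedDeriv n (sharpWeight ψ X U₀) u = (-1 / (2 * U₀)) ^ n * iteratedDeriv n ψ ((X - u) / (2 * U₀)) := by
  have hc : ContDiff ℝ n (fun z => ψ (z + X / (2 * U₀))) :=
    (hψ.contDiff.comp (contDiff_id.add contDiff_const)).of_le (by exact_mod_cast le_top)
  rw [sharpWeight_eq_comp, iteratedDeriv_comp_const_mul hc]
  simp only
  rw [iteratedDeriv_comp_add_const]
  simp only
  rw [show -1 / (2 * U₀) * u + X / (2 * U₀) = (X - u) / (2 * U₀) by ring]

/-- `w♯(u) = 0` unless `X - 2U₀ < u < X + 2U₀` (`U₀ > 0`), and the same for all its derivatives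
when `u ∉ [X-2U₀, X+2U₀]`. [folklore] -/
theorem iteratedDeriv_sharpWeight_eq_zero {ψ : ℝ → ℝ} (hψ : IsSmoothCutoff ψ) {X U₀ : ℝ} (hU₀ : 0 < U₀)
    (n : ℕ) {u : ℝ} (hu : u < X - 2 * U₀ ∨ X + 2 * U₀ < u) : iteratedDeriv n (sharpWeight ψ X U₀) u = 0 := by
  rw [iteratedDeriv_sharpWeight hψ, hψ.iteratedDeriv_eq_zero n ?_, mul_zero]
  rcases hu with hu | hu
  · rw [abs_of_pos (div_pos (by linarith) (by linarith)), lt_div_iff₀ (by linarith)]; linarith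
  · have h1 : (X - u) / (2 * U₀) < -1 := by rw [div_lt_iff₀ (by linarith)]; linarith
    rw [abs_of_neg (by linarith)]; linarith

/-- `w♯(u) = 0` for `u ≤ X - 2U₀` or `u ≥ X + 2U₀` (`U₀ > 0`). [folklore] -/
theorem sharpWeight_eq_zero_of {ψ : ℝ → ℝ} (hψ : IsSmoothCutoff ψ) {X U₀ : ℝ} (hU₀ : 0 < U₀) {u : ℝ}
    (hu : u ≤ X - 2 * U₀ ∨ X + 2 * U₀ ≤ u) : sharpWeight ψ X U₀ u = 0 := by
  unfold sharpWeight
  refine hψ.eq_zero _ ?_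
  rcases hu with hu | hu
  · rw [abs_of_pos (div_pos (by linarith) (by linarith)), le_div_iff₀ (by linarith)]; linarith
  · have h1 : (X - u) / (2 * U₀) ≤ -1 := by rw [div_le_iff₀ (by linarith)]; linarith
    rw [abs_of_neg (by linarith)]; linarith

/-- `W` is supported in `[X-2U₀, X+2U₀]` (`U₀ > 0`). [folklore] -/
theorem sharpW_eq_zero {ψ : ℝ → ℝ} (hψ : IsSmoothCutoff ψ) {X U₀ : ℝ} (hU₀ : 0 < U₀) {u : ℝ}
    (hu : u ≤ X - 2 * U₀ ∨ X + 2 * U₀ ≤ u) : sharpW ψ X U₀ u = 0 := by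
  unfold sharpW
  rw [sharpWeight_eq_zero_of hψ hU₀ hu, zero_mul]

/-- `W` has compact support. [folklore] -/
theorem hasCompactSupport_sharpW {ψ : ℝ → ℝ} (hψ : IsSmoothCutoff ψ) (X : ℝ) {U₀ : ℝ} (hU₀ : 0 < U₀) :
    HasCompactSupport (sharpW ψ X U₀) := by
  refine HasCompactSupport.of_support_subset_isCompact (isCompact_Icc (a := X - 2 * U₀) (b := X + 2 * U₀))
    fun u hu => ?_
  rw [Function.mem_support] at hu
  rw [Set.mem_Icc]
  by_contra h
  rw [not_and_or, not_le, not_le] at h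
  exact hu (sharpW_eq_zero hψ hU₀ (by rcases h with h | h <;> [left; right] <;> linarith))

/-- **Bounds for the derivatives of `W`**: if `|ψ⁽ⁱ⁾| ≤ M_i` for all `i`, then for `U₀ ≥ 1/2`,
`2U₀ ≤ X`: `|W⁽ⁿ⁾(u)| ≤ (2U₀)⁻ⁿ (M_n (X + 2U₀) + 2 n U₀ M_{n-1})` for all `u`
(`W⁽ⁿ⁾ = (w♯)⁽ⁿ⁾ u + n (w♯)⁽ⁿ⁻¹⁾`). [cite: TaoTeravainen2021, proof of Lemma 8.2 ("from integration by
parts (and (8.2)) one has … `≪_m (1+|t|)^{-m}`")] -/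
theorem abs_iteratedDeriv_sharpW_le {ψ : ℝ → ℝ} (hψ : IsSmoothCutoff ψ) {M : ℕ → ℝ}
    (hM : ∀ i u, |iteratedDeriv i ψ u| ≤ M i) {X U₀ : ℝ} (hU₀ : 1 / 2 ≤ U₀) (hX : 2 * U₀ ≤ X) (n : ℕ) (u : ℝ) :
    |iteratedDeriv n (sharpW ψ X U₀) u| ≤
      (1 / (2 * U₀)) ^ n * (M n * (X + 2 * U₀) + 2 * n * U₀ * M (n - 1)) := by
  have hM0 : ∀ i, 0 ≤ M i := fun i => (abs_nonneg _).trans (hM i 0)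
  have hU₀0 : 0 < U₀ := by linarith
  have h2U : 1 ≤ 2 * U₀ := by linarith
  have hXpos : 0 ≤ X + 2 * U₀ := by linarith
  -- the derivatives of `w♯`, with the support information
  have hws : ∀ i v, |iteratedDeriv i (sharpWeight ψ X U₀) v| ≤ (1 / (2 * U₀)) ^ i * M i := by
    intro i v
    rw [iteratedDeriv_sharpWeight hψ, abs_mul, abs_pow, abs_div, abs_neg, abs_one,
      abs_of_pos (by linarith : (0 : ℝ) < 2 * U₀)]
    exact mul_le_mul_of_nonneg_left (hM i _) (pow_nonneg (by positivity) _)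
  -- `|w♯⁽ⁱ⁾(u) u| ≤ (2U₀)^{-i} M_i (X + 2U₀)` (the derivative vanishes unless `|u| ≤ X + 2U₀`)
  have hwu : ∀ i, |iteratedDeriv i (sharpWeight ψ X U₀) u * u| ≤ (1 / (2 * U₀)) ^ i * M i * (X + 2 * U₀) := by
    intro i
    by_cases hu : u < X - 2 * U₀ ∨ X + 2 * U₀ < u
    · rw [iteratedDeriv_sharpWeight_eq_zero hψ hU₀0 i hu, zero_mul, abs_zero]
      exact mul_nonneg (mul_nonneg (pow_nonneg (by positivity) _) (hM0 i)) hXpos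
    · rw [not_or, not_lt, not_lt] at hu
      rw [abs_mul]
      refine mul_le_mul (hws i u) ?_ (abs_nonneg _) (mul_nonneg (pow_nonneg (by positivity) _) (hM0 i))
      rw [abs_le]; constructor <;> linarith [hu.1, hu.2]
  unfold sharpW
  rw [iteratedDeriv_fun_mul (f := sharpWeight ψ X U₀) (g := fun x : ℝ => x)
    (((contDiff_sharpWeight hψ X U₀).of_le (by exact_mod_cast le_top)).contDiffAt) contDiffAt_id]
  -- only `i = n` and `i = n - 1` survive
  have hid : ∀ j, iteratedDeriv j (fun x : ℝ => x) u = if j = 0 then u else if j = 1 then 1 else 0 :=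
    fun j => iteratedDeriv_fun_id
  rcases Nat.eq_zero_or_pos n with rfl | hn
  · rw [Finset.sum_range_one, hid]
    simp only [Nat.choose_self, Nat.cast_one, one_mul, Nat.sub_zero, if_true, pow_zero, Nat.cast_zero,
      mul_zero, zero_mul, add_zero]
    have := hwu 0
    rw [pow_zero, one_mul] at this
    exact this
  · obtain ⟨m, rfl⟩ : ∃ m, n = m + 1 := ⟨n - 1, by omega⟩
    rw [Nat.add_sub_cancel, Finset.sum_range_succ, Finset.sum_range_succ]
    have hrest : ∑ i ∈ Finset.range m, ((m + 1).choose i : ℝ) * iteratedDeriv i (sharpWeight ψ X U₀) u *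
        iteratedDeriv (m + 1 - i) (fun x : ℝ => x) u = 0 := by
      refine Finset.sum_eq_zero fun i hi => ?_
      rw [Finset.mem_range] at hi
      rw [hid, if_neg (by omega), if_neg (by omega), mul_zero]
    rw [hrest, zero_add, hid, hid, if_neg (by omega), if_pos (by omega), Nat.sub_self, if_pos rfl,
      Nat.choose_self, Nat.choose_succ_self_right]
    push_cast
    calc |((m : ℝ) + 1) * iteratedDeriv m (sharpWeight ψ X U₀) u * 1 + 1 * iteratedDeriv (m + 1) (sharpWeight ψ X U₀) u * u|
        ≤ |((m : ℝ) + 1) * iteratedDeriv m (sharpWeight ψ X U₀) u * 1| + |1 * iteratedDeriv (m + 1) (sharpWeight ψ X U₀) u * u| :=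
          abs_add_le _ _
      _ ≤ ((m : ℝ) + 1) * ((1 / (2 * U₀)) ^ m * M m) + (1 / (2 * U₀)) ^ (m + 1) * M (m + 1) * (X + 2 * U₀) := by
          refine add_le_add ?_ ?_
          · rw [mul_one, abs_mul, abs_of_nonneg (by positivity : (0 : ℝ) ≤ (m : ℝ) + 1)]
            exact mul_le_mul_of_nonneg_left (hws _ _) (by positivity)
          · rw [one_mul]; exact hwu (m + 1)
      _ = (1 / (2 * U₀)) ^ (m + 1) * (M (m + 1) * (X + 2 * U₀) + 2 * ((m : ℝ) + 1) * U₀ * M m) := by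
          rw [pow_succ]
          field_simp
          ring

/-! ### `Ψ` as a function of `w = log y`: the convolution `W ⋆ φ` -/

/-- `psiLog := W ⋆ φ`, i.e. `psiLog(w) = ∫ W(u) φ(w - u) du`. [cite: TaoTeravainen2021, §8 (definition
of `Ψ`) and proof of Lemma 8.2] -/
def psiLog (φ ψ : ℝ → ℝ) (X U₀ : ℝ) : ℝ → ℝ := sharpW ψ X U₀ ⋆ φ

/-- `psiLog(w) = ∫ W(u) φ(w - u) du`. [folklore] -/
theorem psiLog_apply (φ ψ : ℝ → ℝ) (X U₀ w : ℝ) : psiLog φ ψ X U₀ w = ∫ u, sharpW ψ X U₀ u * φ (w - u) := by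
  unfold psiLog
  rw [convolution_def]
  rfl

/-- **`Ψ(e^w) = psiLog(w)`** once `3U₀ ≤ X` (`U₀ > 0`): the constraint `u > U₀` in `Ψ` is implied by
the support of `w♯`. [cite: TaoTeravainen2021, §8] -/
theorem psiSharp_exp_eq_psiLog (φ : ℝ → ℝ) {ψ : ℝ → ℝ} (hψ : IsSmoothCutoff ψ) {X U₀ : ℝ} (hU₀ : 0 < U₀)
    (hX : 3 * U₀ ≤ X) (w : ℝ) : psiSharp φ ψ X U₀ (Real.exp w) = psiLog φ ψ X U₀ w := by
  rw [psiLog_apply]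
  unfold psiSharp
  rw [Real.log_exp]
  have hzero : ∀ u, u ∉ Set.Ioi U₀ → sharpWeight ψ X U₀ u * φ (w - u) * u = 0 := by
    intro u hu
    rw [Set.mem_Ioi, not_lt] at hu
    rw [sharpWeight_eq_zero_of hψ hU₀ (Or.inl (by linarith)), zero_mul, zero_mul]
  rw [setIntegral_eq_integral_of_forall_compl_eq_zero hzero]
  refine integral_congr_ae (Eventually.of_forall fun u => ?_)
  simp only [sharpW]; ring

/-- `psiLog` is smooth. [folklore] -/
theorem contDiff_psiLog {φ ψ : ℝ → ℝ} (hφ : IsBump φ) (hψ : IsSmoothCutoff ψ) (X : ℝ) {U₀ : ℝ} (hU₀ : 0 < U₀) :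
    ContDiff ℝ ∞ (psiLog φ ψ X U₀) :=
  (hasCompactSupport_sharpW hψ X hU₀).contDiff_convolution_left _ (contDiff_sharpW hψ X U₀)
    hφ.continuous.locallyIntegrable

/-- `psiLog(w) = 0` unless `X - 2U₀ - 1 < w < X + 2U₀ + 1`. [folklore] -/
theorem psiLog_eq_zero {φ ψ : ℝ → ℝ} (hφ : IsBump φ) (hψ : IsSmoothCutoff ψ) {X U₀ : ℝ} (hU₀ : 0 < U₀) {w : ℝ}
    (hw : w ≤ X - 2 * U₀ - 1 ∨ X + 2 * U₀ + 1 ≤ w) : psiLog φ ψ X U₀ w = 0 := by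
  rw [psiLog_apply]
  refine integral_eq_zero_of_ae (Eventually.of_forall fun u => ?_)
  simp only [Pi.zero_apply]
  by_cases hu : u ≤ X - 2 * U₀ ∨ X + 2 * U₀ ≤ u
  · rw [sharpW_eq_zero hψ hU₀ hu, zero_mul]
  · rw [not_or, not_le, not_le] at hu
    rw [hφ.eq_zero _ ?_, mul_zero]
    rcases hw with hw | hw
    · rw [abs_of_nonpos (by linarith [hu.1])]; linarith [hu.1]
    · rw [abs_of_nonneg (by linarith [hu.2])]; linarith [hu.2]

/-- `psiLog` has compact support. [folklore] -/
theorem hasCompactSupport_psiLog {φ ψ : ℝ → ℝ} (hφ : IsBump φ) (hψ : IsSmoothCutoff ψ) (X : ℝ) {U₀ : ℝ}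
    (hU₀ : 0 < U₀) : HasCompactSupport (psiLog φ ψ X U₀) :=
  (hasCompactSupport_sharpW hψ X hU₀).convolution _ hφ.hasCompactSupport

/-- **Derivatives fall on `W`**: `psiLog⁽ⁿ⁾ = W⁽ⁿ⁾ ⋆ φ`. [cite: TaoTeravainen2021, proof of Lemma 8.2
("integration by parts")] -/
theorem iteratedDeriv_psiLog {φ ψ : ℝ → ℝ} (hφ : IsBump φ) (hψ : IsSmoothCutoff ψ) (X : ℝ) {U₀ : ℝ}
    (hU₀ : 0 < U₀) (n : ℕ) : iteratedDeriv n (psiLog φ ψ X U₀) = iteratedDeriv n (sharpW ψ X U₀) ⋆ φ := by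
  induction n with
  | zero => simp only [iteratedDeriv_zero]; rfl
  | succ n ih =>
    rw [iteratedDeriv_succ, ih, iteratedDeriv_succ]
    have hcs : HasCompactSupport (iteratedDeriv n (sharpW ψ X U₀)) := by
      clear ih
      induction n with
      | zero => simpa [iteratedDeriv_zero] using hasCompactSupport_sharpW hψ X hU₀
      | succ n ih' => rw [iteratedDeriv_succ]; exact ih'.deriv
    have hcd : ContDiff ℝ 1 (iteratedDeriv n (sharpW ψ X U₀)) := by
      rw [iteratedDeriv_eq_iterate]
      exact ((contDiff_sharpW hψ X U₀).iterate_deriv n).of_le (by exact_mod_cast le_top)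
    ext w
    exact (hcs.hasDerivAt_convolution_left _ hcd hφ.continuous.locallyIntegrable w).deriv

/-- **`|psiLog⁽ⁿ⁾(w)| ≤ sup|W⁽ⁿ⁾|`** (`∫φ = 1`, `φ ≥ 0`). [cite: TaoTeravainen2021, proof of Lemma 8.2] -/
theorem abs_iteratedDeriv_psiLog_le {φ ψ : ℝ → ℝ} (hφ : IsBump φ) (hψ : IsSmoothCutoff ψ) (X : ℝ) {U₀ : ℝ}
    (hU₀ : 0 < U₀) (n : ℕ) {K : ℝ} (hK : ∀ u, |iteratedDeriv n (sharpW ψ X U₀) u| ≤ K) (w : ℝ) :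
    |iteratedDeriv n (psiLog φ ψ X U₀) w| ≤ K := by
  have hK0 : 0 ≤ K := (abs_nonneg _).trans (hK 0)
  rw [iteratedDeriv_psiLog hφ hψ X hU₀ n, convolution_def]
  simp only [ContinuousLinearMap.lsmul_apply, smul_eq_mul]
  calc |∫ u, iteratedDeriv n (sharpW ψ X U₀) u * φ (w - u)|
      ≤ ∫ u, |iteratedDeriv n (sharpW ψ X U₀) u * φ (w - u)| := by
        have := norm_integral_le_integral_norm (μ := volume) (fun u => iteratedDeriv n (sharpW ψ X U₀) u * φ (w - u))
        simpa only [Real.norm_eq_abs] using this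
    _ ≤ ∫ u, K * φ (w - u) := by
        refine integral_mono_of_nonneg (Eventually.of_forall fun u => abs_nonneg _)
          ((hφ.integrable.comp_sub_left w).const_mul K) (Eventually.of_forall fun u => ?_)
        simp only
        rw [abs_mul, abs_of_nonneg (hφ.nonneg _)]
        exact mul_le_mul_of_nonneg_right (hK u) (hφ.nonneg _)
    _ = K := by
        rw [integral_const_mul, integral_sub_left_eq_self (f := φ) (μ := volume), hφ.integral_eq, mul_one]

/-! ### The twisted profile `g_c(v) = e^{v/X} psiLog(c - v)` and its Fourier transform -/

/-- The real profile `gR_c(v) := e^{v/X} psiLog(c - v)` (`v = log d`, `c = log(y+h)`).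
[cite: TaoTeravainen2021, proof of Lemma 8.2 (the function of `s = log(x/t)/log x`)] -/
def psiTwistR (φ ψ : ℝ → ℝ) (X U₀ c v : ℝ) : ℝ := Real.exp (X⁻¹ * v) * psiLog φ ψ X U₀ (c - v)

/-- Its complexification `g_c`. [cite: TaoTeravainen2021, proof of Lemma 8.2] -/
def psiTwist (φ ψ : ℝ → ℝ) (X U₀ c : ℝ) : ℝ → ℂ := fun v => ((psiTwistR φ ψ X U₀ c v : ℝ) : ℂ)

/-- **`F`** (our normalisation of the source's `F_j`): `ĝ_c := 𝓕 g_c`. [cite: TaoTeravainen2021,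
Lemma 8.2 (the function `F_j`)] -/
def psiFourier (φ ψ : ℝ → ℝ) (X U₀ c : ℝ) : ℝ → ℂ := 𝓕 (psiTwist φ ψ X U₀ c)

/-- `gR_c` is smooth. [folklore] -/
theorem contDiff_psiTwistR {φ ψ : ℝ → ℝ} (hφ : IsBump φ) (hψ : IsSmoothCutoff ψ) (X : ℝ) {U₀ : ℝ}
    (hU₀ : 0 < U₀) (c : ℝ) : ContDiff ℝ ∞ (psiTwistR φ ψ X U₀ c) := by
  unfold psiTwistR
  exact (Real.contDiff_exp.comp (contDiff_const.mul contDiff_id)).mul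
    ((contDiff_psiLog hφ hψ X hU₀).comp (contDiff_const.sub contDiff_id))

/-- `g_c` is smooth. [folklore] -/
theorem contDiff_psiTwist {φ ψ : ℝ → ℝ} (hφ : IsBump φ) (hψ : IsSmoothCutoff ψ) (X : ℝ) {U₀ : ℝ}
    (hU₀ : 0 < U₀) (c : ℝ) : ContDiff ℝ ∞ (psiTwist φ ψ X U₀ c) :=
  ofRealCLM.contDiff.comp (contDiff_psiTwistR hφ hψ X hU₀ c)

/-- `g_c(v) = 0` off `[c - X - 2U₀ - 1, c - X + 2U₀ + 1]`. [folklore] -/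
theorem psiTwistR_eq_zero {φ ψ : ℝ → ℝ} (hφ : IsBump φ) (hψ : IsSmoothCutoff ψ) {X U₀ : ℝ} (hU₀ : 0 < U₀)
    (c : ℝ) {v : ℝ} (hv : v ∉ Set.Icc (c - X - 2 * U₀ - 1) (c - X + 2 * U₀ + 1)) :
    psiTwistR φ ψ X U₀ c v = 0 := by
  unfold psiTwistR
  rw [psiLog_eq_zero hφ hψ hU₀ ?_, mul_zero]
  rw [Set.mem_Icc, not_and_or, not_le, not_le] at hv
  rcases hv with hv | hv
  · right; linarith
  · left; linarith

/-- `g_c` has compact support. [folklore] -/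
theorem hasCompactSupport_psiTwist {φ ψ : ℝ → ℝ} (hφ : IsBump φ) (hψ : IsSmoothCutoff ψ) (X : ℝ) {U₀ : ℝ}
    (hU₀ : 0 < U₀) (c : ℝ) : HasCompactSupport (psiTwist φ ψ X U₀ c) := by
  refine HasCompactSupport.of_support_subset_isCompact (isCompact_Icc (a := c - X - 2 * U₀ - 1)
    (b := c - X + 2 * U₀ + 1)) fun v hv => ?_
  rw [Function.mem_support] at hv
  by_contra h
  exact hv (by unfold psiTwist; rw [psiTwistR_eq_zero hφ hψ hU₀ c h, Complex.ofReal_zero])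

/-- Sums of the derivative bounds of `ψ` up to order `n`. [folklore] -/
def cutoffDerivSum (M : ℕ → ℝ) (n : ℕ) : ℝ := ∑ j ∈ Finset.range (n + 1), M j

/-- `M j ≤ cutoffDerivSum M n` for `j ≤ n` (`M ≥ 0`). [folklore] -/
theorem le_cutoffDerivSum {M : ℕ → ℝ} (hM : ∀ i, 0 ≤ M i) {j n : ℕ} (hj : j ≤ n) : M j ≤ cutoffDerivSum M n := by
  unfold cutoffDerivSum
  exact Finset.single_le_sum (fun i _ => hM i) (Finset.mem_range.mpr (by omega))

/-- **Derivative bounds for `gR_c`**: with `|ψ⁽ⁱ⁾| ≤ M_i`, `U₀ ≥ 1/2`, `2U₀ ≤ X`, `1 ≤ X`: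
`|gR_c⁽ⁿ⁾(v)| ≤ e^{v/X} (1/U₀)ⁿ 2ⁿ (1+n) (X + 2U₀) S_n`, `S_n = ∑_{j≤n} M_j`.
[cite: TaoTeravainen2021, proof of Lemma 8.2] -/
theorem abs_iteratedDeriv_psiTwistR_le {φ ψ : ℝ → ℝ} (hφ : IsBump φ) (hψ : IsSmoothCutoff ψ) {M : ℕ → ℝ}
    (hM : ∀ i u, |iteratedDeriv i ψ u| ≤ M i) {X U₀ : ℝ} (hU₀ : 1 / 2 ≤ U₀) (hX : 2 * U₀ ≤ X) (hX1 : 1 ≤ X)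
    (c : ℝ) (n : ℕ) (v : ℝ) :
    |iteratedDeriv n (psiTwistR φ ψ X U₀ c) v| ≤
      Real.exp (X⁻¹ * v) * (1 / U₀) ^ n * 2 ^ n * ((1 + n) * (X + 2 * U₀) * cutoffDerivSum M n) := by
  have hM0 : ∀ i, 0 ≤ M i := fun i => (abs_nonneg _).trans (hM i 0)
  have hU₀0 : 0 < U₀ := by linarith
  have hX0 : 0 < X := by linarith
  have hXU : 0 ≤ X + 2 * U₀ := by linarith
  have hS0 : 0 ≤ cutoffDerivSum M n := Finset.sum_nonneg fun i _ => hM0 i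
  -- bounds for the two factors
  set K : ℕ → ℝ := fun i => (1 / X) ^ i * Real.exp (X⁻¹ * v) with hK
  set G : ℕ → ℝ := fun j => (1 / (2 * U₀)) ^ j * (M j * (X + 2 * U₀) + 2 * j * U₀ * M (j - 1)) with hG
  have hKb : ∀ i ≤ n, |iteratedDeriv i (fun s => Real.exp (X⁻¹ * s)) v| ≤ K i := by
    intro i _
    rw [iteratedDeriv_exp_const_mul, abs_mul, abs_pow, abs_of_pos (Real.exp_pos _), abs_of_pos (by positivity)]
    simp only [hK, one_div]; rfl
  have hGb : ∀ j ≤ n, |iteratedDeriv j (fun s => psiLog φ ψ X U₀ (c - s)) v| ≤ G j := by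
    intro j _
    rw [iteratedDeriv_comp_const_sub]
    simp only [smul_eq_mul]
    rw [abs_mul, abs_pow, abs_neg, abs_one, one_pow, one_mul]
    exact abs_iteratedDeriv_psiLog_le hφ hψ X hU₀0 j (abs_iteratedDeriv_sharpW_le hψ hM hU₀ hX j) _
  have hcf : ContDiff ℝ n (fun s => Real.exp (X⁻¹ * s)) :=
    (Real.contDiff_exp.comp (contDiff_const.mul contDiff_id)).of_le (by exact_mod_cast le_top)
  have hcg : ContDiff ℝ n (fun s => psiLog φ ψ X U₀ (c - s)) :=
    ((contDiff_psiLog hφ hψ X hU₀0).comp (contDiff_const.sub contDiff_id)).of_le (by exact_mod_cast le_top)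
  have h := abs_iteratedDeriv_mul_le_of_bounds (f := fun s => Real.exp (X⁻¹ * s))
    (g := fun s => psiLog φ ψ X U₀ (c - s)) (x := v) (k := n) hcf.contDiffAt hcg.contDiffAt hKb hGb
  change |iteratedDeriv n ((fun s => Real.exp (X⁻¹ * s)) * fun s => psiLog φ ψ X U₀ (c - s)) v| ≤ _
  refine h.trans ?_
  -- each term: `C(n,i) K_i G_{n-i} ≤ C(n,i) e^{v/X} U₀^{-n} (1+n)(X+2U₀) S_n`
  have hterm : ∀ i ∈ Finset.range (n + 1), (n.choose i : ℝ) * K i * G (n - i) ≤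
      (n.choose i : ℝ) * (Real.exp (X⁻¹ * v) * (1 / U₀) ^ n * ((1 + n) * (X + 2 * U₀) * cutoffDerivSum M n)) := by
    intro i hi
    rw [Finset.mem_range] at hi
    rw [mul_assoc]
    refine mul_le_mul_of_nonneg_left ?_ (Nat.cast_nonneg _)
    simp only [hK, hG]
    -- `(1/X)^i (1/(2U₀))^{n-i} ≤ (1/U₀)^n`… more precisely `≤ (1/(2U₀))^n ≤ (1/U₀)^n`
    have h1 : (1 / X) ^ i * (1 / (2 * U₀)) ^ (n - i) ≤ (1 / U₀) ^ n := by
      have h2 : (1 / X) ^ i ≤ (1 / (2 * U₀)) ^ i :=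
        pow_le_pow_left₀ (by positivity) (one_div_le_one_div_of_le (by positivity) hX) i
      calc (1 / X) ^ i * (1 / (2 * U₀)) ^ (n - i) ≤ (1 / (2 * U₀)) ^ i * (1 / (2 * U₀)) ^ (n - i) :=
            mul_le_mul_of_nonneg_right h2 (by positivity)
        _ = (1 / (2 * U₀)) ^ n := by rw [← pow_add, Nat.add_sub_cancel' (by omega)]
        _ ≤ (1 / U₀) ^ n := pow_le_pow_left₀ (by positivity) (one_div_le_one_div_of_le hU₀0 (by linarith)) n
    have h3 : M (n - i) * (X + 2 * U₀) + 2 * ((n - i : ℕ) : ℝ) * U₀ * M (n - i - 1) ≤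
        (1 + n) * (X + 2 * U₀) * cutoffDerivSum M n := by
      have hm1 : M (n - i) ≤ cutoffDerivSum M n := le_cutoffDerivSum hM0 (by omega)
      have hm2 : M (n - i - 1) ≤ cutoffDerivSum M n := le_cutoffDerivSum hM0 (by omega)
      have hni : ((n - i : ℕ) : ℝ) ≤ n := by exact_mod_cast Nat.sub_le n i
      have h2U : 2 * U₀ ≤ X + 2 * U₀ := by linarith
      calc M (n - i) * (X + 2 * U₀) + 2 * ((n - i : ℕ) : ℝ) * U₀ * M (n - i - 1)
          ≤ cutoffDerivSum M n * (X + 2 * U₀) + n * (X + 2 * U₀) * cutoffDerivSum M n := by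
            refine add_le_add (mul_le_mul_of_nonneg_right hm1 hXU) ?_
            calc 2 * ((n - i : ℕ) : ℝ) * U₀ * M (n - i - 1) = ((n - i : ℕ) : ℝ) * (2 * U₀) * M (n - i - 1) := by ring
              _ ≤ (n : ℝ) * (X + 2 * U₀) * cutoffDerivSum M n := by
                  refine mul_le_mul (mul_le_mul hni h2U (by linarith) (Nat.cast_nonneg _)) hm2 (hM0 _) (by positivity)
        _ = (1 + n) * (X + 2 * U₀) * cutoffDerivSum M n := by ring
    calc (1 / X) ^ i * Real.exp (X⁻¹ * v) * ((1 / (2 * U₀)) ^ (n - i) *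
          (M (n - i) * (X + 2 * U₀) + 2 * ((n - i : ℕ) : ℝ) * U₀ * M (n - i - 1)))
        = Real.exp (X⁻¹ * v) * ((1 / X) ^ i * (1 / (2 * U₀)) ^ (n - i)) *
          (M (n - i) * (X + 2 * U₀) + 2 * ((n - i : ℕ) : ℝ) * U₀ * M (n - i - 1)) := by ring
      _ ≤ Real.exp (X⁻¹ * v) * (1 / U₀) ^ n * ((1 + n) * (X + 2 * U₀) * cutoffDerivSum M n) := by
          refine mul_le_mul (mul_le_mul_of_nonneg_left h1 (Real.exp_pos _).le) h3 ?_ (by positivity)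
          have : 0 ≤ 2 * ((n - i : ℕ) : ℝ) * U₀ * M (n - i - 1) := by
            have := hM0 (n - i - 1); positivity
          have := hM0 (n - i); positivity
  refine (Finset.sum_le_sum hterm).trans ?_
  rw [← Finset.sum_mul]
  have hchoose : ∑ i ∈ Finset.range (n + 1), (n.choose i : ℝ) = 2 ^ n := by
    have := Nat.sum_range_choose n
    exact_mod_cast this
  rw [hchoose]
  ring_nf
  rfl

/-- **The size of `gR_c` and its derivatives on its support**: for `c ≤ X + 1`, `2U₀ + 2 ≤ X`, on the
support `e^{v/X} ≤ e`. [folklore] -/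
theorem exp_le_of_mem_support {X U₀ c v : ℝ} (hX : 2 * U₀ + 2 ≤ X) (hX1 : 1 ≤ X) (hc : c ≤ X + 1)
    (hv : v ∈ Set.Icc (c - X - 2 * U₀ - 1) (c - X + 2 * U₀ + 1)) : Real.exp (X⁻¹ * v) ≤ Real.exp 1 := by
  rw [Set.mem_Icc] at hv
  refine Real.exp_le_exp.mpr ?_
  have hX0 : 0 < X := by linarith
  rw [inv_mul_le_iff₀ hX0]
  linarith [hv.2]


/-! ### Fourier decay of `ĝ_c` -/

/-- `tsupport g_c ⊆ [c - X - 2U₀ - 1, c - X + 2U₀ + 1]`. [folklore] -/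
theorem tsupport_psiTwist_subset {φ ψ : ℝ → ℝ} (hφ : IsBump φ) (hψ : IsSmoothCutoff ψ) (X : ℝ) {U₀ : ℝ}
    (hU₀ : 0 < U₀) (c : ℝ) :
    tsupport (psiTwist φ ψ X U₀ c) ⊆ Set.Icc (c - X - 2 * U₀ - 1) (c - X + 2 * U₀ + 1) := by
  refine closure_minimal (fun v hv => ?_) isClosed_Icc
  rw [Function.mem_support] at hv
  by_contra h
  exact hv (by unfold psiTwist; rw [psiTwistR_eq_zero hφ hψ hU₀ c h, Complex.ofReal_zero])

/-- **Uniform bound for `g_c⁽ⁿ⁾`** on `ℝ`: `‖g_c⁽ⁿ⁾(v)‖ ≤ e (1/U₀)ⁿ 2ⁿ (1+n)(X+2U₀) S_n`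
(`U₀ ≥ 1/2`, `2U₀ + 2 ≤ X`, `c ≤ X + 1`). [folklore] -/
theorem norm_iteratedDeriv_psiTwist_le {φ ψ : ℝ → ℝ} (hφ : IsBump φ) (hψ : IsSmoothCutoff ψ) {M : ℕ → ℝ}
    (hM : ∀ i u, |iteratedDeriv i ψ u| ≤ M i) {X U₀ : ℝ} (hU₀ : 1 / 2 ≤ U₀) (hX : 2 * U₀ + 2 ≤ X) {c : ℝ}
    (hc : c ≤ X + 1) (n : ℕ) (v : ℝ) :
    ‖iteratedDeriv n (psiTwist φ ψ X U₀ c) v‖ ≤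
      Real.exp 1 * (1 / U₀) ^ n * 2 ^ n * ((1 + n) * (X + 2 * U₀) * cutoffDerivSum M n) := by
  have hM0 : ∀ i, 0 ≤ M i := fun i => (abs_nonneg _).trans (hM i 0)
  have hU₀0 : 0 < U₀ := by linarith
  have hX1 : 1 ≤ X := by linarith
  have hS0 : 0 ≤ cutoffDerivSum M n := Finset.sum_nonneg fun i _ => hM0 i
  have hA0 : 0 ≤ (1 + (n : ℝ)) * (X + 2 * U₀) * cutoffDerivSum M n := by
    have : 0 ≤ X + 2 * U₀ := by linarith
    positivity
  by_cases hv : v ∈ Set.Icc (c - X - 2 * U₀ - 1) (c - X + 2 * U₀ + 1)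
  · unfold psiTwist
    rw [iteratedDeriv_ofReal_comp (contDiff_psiTwistR hφ hψ X hU₀0 c) n]
    simp only [Complex.norm_real, Real.norm_eq_abs]
    refine (abs_iteratedDeriv_psiTwistR_le hφ hψ hM hU₀ (by linarith) hX1 c n v).trans ?_
    have he := exp_le_of_mem_support (by linarith) hX1 hc hv
    have : 0 ≤ (1 / U₀) ^ n * 2 ^ n * ((1 + n) * (X + 2 * U₀) * cutoffDerivSum M n) := by positivity
    calc Real.exp (X⁻¹ * v) * (1 / U₀) ^ n * 2 ^ n * ((1 + n) * (X + 2 * U₀) * cutoffDerivSum M n)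
        = Real.exp (X⁻¹ * v) * ((1 / U₀) ^ n * 2 ^ n * ((1 + n) * (X + 2 * U₀) * cutoffDerivSum M n)) := by ring
      _ ≤ Real.exp 1 * ((1 / U₀) ^ n * 2 ^ n * ((1 + n) * (X + 2 * U₀) * cutoffDerivSum M n)) :=
          mul_le_mul_of_nonneg_right he this
      _ = _ := by ring
  · rw [Literature.NumberTheory.LFunctions.GuthMaynardFourier.iteratedDeriv_eq_zero_of_notMem_tsupport
      (fun h => hv (tsupport_psiTwist_subset hφ hψ X hU₀0 c h)) n, norm_zero]
    positivity

/-- **`L¹` bounds**: `∫ ‖g_c⁽ⁿ⁾‖ ≤ 6U₀ · e (1/U₀)ⁿ 2ⁿ (1+n)(X+2U₀) S_n` (`U₀ ≥ 1`). [folklore] -/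
theorem integral_norm_iteratedDeriv_psiTwist_le {φ ψ : ℝ → ℝ} (hφ : IsBump φ) (hψ : IsSmoothCutoff ψ)
    {M : ℕ → ℝ} (hM : ∀ i u, |iteratedDeriv i ψ u| ≤ M i) {X U₀ : ℝ} (hU₀ : 1 ≤ U₀) (hX : 2 * U₀ + 2 ≤ X)
    {c : ℝ} (hc : c ≤ X + 1) (n : ℕ) :
    ∫ v, ‖iteratedDeriv n (psiTwist φ ψ X U₀ c) v‖ ≤
      6 * U₀ * (Real.exp 1 * (1 / U₀) ^ n * 2 ^ n * ((1 + n) * (X + 2 * U₀) * cutoffDerivSum M n)) := by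
  have hU₀0 : 0 < U₀ := by linarith
  have h := integral_norm_le_of_bound_Icc (g := iteratedDeriv n (psiTwist φ ψ X U₀ c))
    (a := c - X - 2 * U₀ - 1) (b := c - X + 2 * U₀ + 1) (by linarith)
    (norm_iteratedDeriv_psiTwist_le hφ hψ hM (by linarith) hX hc n) fun v hv =>
      Literature.NumberTheory.LFunctions.GuthMaynardFourier.iteratedDeriv_eq_zero_of_notMem_tsupport
        (fun h => hv (tsupport_psiTwist_subset hφ hψ X hU₀0 c h)) n
  refine h.trans ?_
  have hM0 : ∀ i, 0 ≤ M i := fun i => (abs_nonneg _).trans (hM i 0)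
  have hS0 : 0 ≤ cutoffDerivSum M n := Finset.sum_nonneg fun i _ => hM0 i
  have : 0 ≤ Real.exp 1 * (1 / U₀) ^ n * 2 ^ n * ((1 + n) * (X + 2 * U₀) * cutoffDerivSum M n) := by
    have : 0 ≤ X + 2 * U₀ := by linarith
    positivity
  rw [mul_comm]
  refine mul_le_mul_of_nonneg_right ?_ this
  ring_nf; linarith

/-- **Fourier decay of `ĝ_c` on the scale `1/U₀`**: for `U₀ ≥ 1`, `2U₀ + 2 ≤ X`, `c ≤ X + 1` and every
`n`, `(1 + U₀|τ|)ⁿ ‖ĝ_c(τ)‖ ≤ 2ⁿ 6e U₀ (1+n)(X+2U₀) S_n` ("`F_j(t) ≪_m (1+|t|)^{-m}`", with the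
constants made explicit in `X = log x` and `U₀ = log(Dq²)`). [cite: TaoTeravainen2021, Lemma 8.2 (8.14)] -/
theorem psiFourier_decay {φ ψ : ℝ → ℝ} (hφ : IsBump φ) (hψ : IsSmoothCutoff ψ) {M : ℕ → ℝ}
    (hM : ∀ i u, |iteratedDeriv i ψ u| ≤ M i) {X U₀ : ℝ} (hU₀ : 1 ≤ U₀) (hX : 2 * U₀ + 2 ≤ X) {c : ℝ}
    (hc : c ≤ X + 1) (n : ℕ) (τ : ℝ) :
    (1 + U₀ * |τ|) ^ n * ‖psiFourier φ ψ X U₀ c τ‖ ≤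
      2 ^ n * (6 * Real.exp 1) * U₀ * ((1 + n) * (X + 2 * U₀) * cutoffDerivSum M n) := by
  have hM0 : ∀ i, 0 ≤ M i := fun i => (abs_nonneg _).trans (hM i 0)
  have hU₀0 : 0 < U₀ := by linarith
  have hXU : 0 ≤ X + 2 * U₀ := by linarith
  set A : ℕ → ℝ := fun k => (1 + (k : ℝ)) * (X + 2 * U₀) * cutoffDerivSum M k with hA
  have hAmono : A 0 ≤ A n := by
    simp only [hA]
    refine mul_le_mul (mul_le_mul_of_nonneg_right (by simp) hXU) ?_ (Finset.sum_nonneg fun i _ => hM0 i)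
      (by positivity)
    unfold cutoffDerivSum
    exact Finset.sum_le_sum_of_subset_of_nonneg (Finset.range_subset_range.mpr (by omega)) fun i _ _ => hM0 i
  have hA0 : 0 ≤ A 0 := by
    simp only [hA]
    exact mul_nonneg (mul_nonneg (by norm_num) hXU) (Finset.sum_nonneg fun i _ => hM0 i)
  have hAn : 0 ≤ A n := hA0.trans hAmono
  have hcont := contDiff_psiTwist hφ hψ X hU₀0 c
  have hsupp := hasCompactSupport_psiTwist hφ hψ X hU₀0 c
  -- the two Fourier bounds
  have h0 : ‖psiFourier φ ψ X U₀ c τ‖ ≤ 6 * U₀ * (Real.exp 1 * A 0) := by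
    refine (norm_fourier_le_integral_norm _ _).trans ?_
    have := integral_norm_iteratedDeriv_psiTwist_le hφ hψ hM hU₀ hX hc 0
    simp only [iteratedDeriv_zero, pow_zero, mul_one, Nat.cast_zero] at this
    simpa [hA] using this
  by_cases hτ : U₀ * |τ| ≤ 1
  · calc (1 + U₀ * |τ|) ^ n * ‖psiFourier φ ψ X U₀ c τ‖ ≤ 2 ^ n * (6 * U₀ * (Real.exp 1 * A 0)) := by
          refine mul_le_mul (pow_le_pow_left₀ (by positivity) (by linarith) n) h0 (norm_nonneg _) (by positivity)
      _ ≤ 2 ^ n * (6 * Real.exp 1) * U₀ * A n := by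
          have : 6 * U₀ * (Real.exp 1 * A 0) ≤ 6 * U₀ * (Real.exp 1 * A n) := by gcongr
          nlinarith [pow_pos (show (0:ℝ) < 2 by norm_num) n]
  · push Not at hτ
    have hτ0 : τ ≠ 0 := by
      intro h; rw [h, abs_zero, mul_zero] at hτ; linarith
    have hτpos : 0 < |τ| := abs_pos.mpr hτ0
    have hn := norm_fourier_le_of_iteratedDeriv hcont hsupp n hτ0
    have hI := integral_norm_iteratedDeriv_psiTwist_le hφ hψ hM hU₀ hX hc n
    have hden : 0 < (2 * π * |τ|) ^ n := by positivity
    -- `(1 + U₀|τ|)^n ≤ (2U₀|τ|)^n`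
    have h1 : (1 + U₀ * |τ|) ^ n ≤ (2 * (U₀ * |τ|)) ^ n := pow_le_pow_left₀ (by positivity) (by linarith) n
    calc (1 + U₀ * |τ|) ^ n * ‖psiFourier φ ψ X U₀ c τ‖
        ≤ (2 * (U₀ * |τ|)) ^ n * ((6 * U₀ * (Real.exp 1 * (1 / U₀) ^ n * 2 ^ n * A n)) / (2 * π * |τ|) ^ n) := by
          refine mul_le_mul h1 (hn.trans (div_le_div_of_nonneg_right hI hden.le)) (norm_nonneg _) (by positivity)
      _ = (6 * Real.exp 1) * U₀ * A n * ((2 * (U₀ * |τ|)) ^ n * (1 / U₀) ^ n * 2 ^ n / (2 * π * |τ|) ^ n) := by ring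
      _ = (6 * Real.exp 1) * U₀ * A n * (2 / π) ^ n := by
          congr 1
          rw [div_eq_iff hden.ne', ← mul_pow, ← mul_pow, ← mul_pow]
          congr 1
          field_simp
      _ ≤ (6 * Real.exp 1) * U₀ * A n * 2 ^ n := by
          refine mul_le_mul_of_nonneg_left (pow_le_pow_left₀ (by positivity) ?_ n) (by positivity)
          rw [div_le_iff₀ Real.pi_pos]
          have := Real.pi_gt_three; nlinarith
      _ = 2 ^ n * (6 * Real.exp 1) * U₀ * A n := by ring

/-- `τ ↦ (1 + U₀|τ|)^{-2}` is integrable (`U₀ > 0`). [folklore] -/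
theorem integrable_one_add_mul_abs_pow_neg_two {U₀ : ℝ} (hU₀ : 0 < U₀) :
    Integrable fun τ : ℝ => ((1 + U₀ * |τ|) ^ 2)⁻¹ := by
  have h := integrable_one_add_norm (E := ℝ) (μ := volume) (r := 2) (by simp)
  have h2 : Integrable fun t : ℝ => ((1 + |t|) ^ 2)⁻¹ := by
    refine h.congr (Eventually.of_forall fun t => ?_)
    simp only [Real.norm_eq_abs]
    rw [Real.rpow_neg (by positivity), Real.rpow_two]
  have h3 := h2.comp_mul_left' hU₀.ne'
  refine h3.congr (Eventually.of_forall fun t => ?_)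
  simp only
  rw [abs_mul, abs_of_pos hU₀]

/-- **Integrability of `(1+U₀|τ|)^k ‖ĝ_c(τ)‖`-weighted transforms**: for every `k`,
`τ ↦ (1 + U₀|τ|)^k ĝ_c(τ)`-sized functions are integrable; we record the cases used:
`ĝ_c` and `τ ĝ_c(τ)` are integrable. [folklore] -/
theorem integrable_psiFourier {φ ψ : ℝ → ℝ} (hφ : IsBump φ) (hψ : IsSmoothCutoff ψ) {X U₀ : ℝ}
    (hU₀ : 1 ≤ U₀) (hX : 2 * U₀ + 2 ≤ X) {c : ℝ} (hc : c ≤ X + 1) :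
    Integrable (psiFourier φ ψ X U₀ c) ∧ Integrable (fun τ : ℝ => (τ : ℂ) * psiFourier φ ψ X U₀ c τ) := by
  have hU₀0 : 0 < U₀ := by linarith
  obtain ⟨M, hM⟩ : ∃ M : ℕ → ℝ, ∀ i u, |iteratedDeriv i ψ u| ≤ M i := by
    choose M _ hM using hψ.exists_bound_iteratedDeriv'
    exact ⟨M, hM⟩
  have hcontF : Continuous (psiFourier φ ψ X U₀ c) :=
    VectorFourier.fourierIntegral_continuous Real.continuous_fourierChar (by exact continuous_inner)
      ((contDiff_psiTwist hφ hψ X hU₀0 c).continuous.integrable_of_hasCompactSupport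
        (hasCompactSupport_psiTwist hφ hψ X hU₀0 c))
  set C3 : ℝ := 2 ^ 3 * (6 * Real.exp 1) * U₀ * ((1 + (3 : ℕ)) * (X + 2 * U₀) * cutoffDerivSum M 3) with hC3
  have hdec : ∀ τ, (1 + U₀ * |τ|) ^ 3 * ‖psiFourier φ ψ X U₀ c τ‖ ≤ C3 := fun τ =>
    psiFourier_decay hφ hψ hM hU₀ hX hc 3 τ
  have hdom := (integrable_one_add_mul_abs_pow_neg_two hU₀0).const_mul (C3 * (1 + U₀⁻¹))
  constructor
  · refine hdom.mono' hcontF.aestronglyMeasurable (Eventually.of_forall fun τ => ?_)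
    have h1 : 1 ≤ 1 + U₀ * |τ| := by have := abs_nonneg τ; nlinarith
    have hpos : 0 < (1 + U₀ * |τ|) ^ 2 := by positivity
    rw [← div_eq_mul_inv, le_div_iff₀ hpos]
    calc ‖psiFourier φ ψ X U₀ c τ‖ * (1 + U₀ * |τ|) ^ 2 ≤ ‖psiFourier φ ψ X U₀ c τ‖ * (1 + U₀ * |τ|) ^ 3 :=
          mul_le_mul_of_nonneg_left (pow_le_pow_right₀ h1 (by norm_num)) (norm_nonneg _)
      _ ≤ C3 := by rw [mul_comm]; exact hdec τ
      _ ≤ C3 * (1 + U₀⁻¹) := le_mul_of_one_le_right ((by positivity : (0:ℝ) ≤ _) |>.trans (hdec 0)) (by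
          have : 0 ≤ U₀⁻¹ := by positivity
          linarith)
  · refine hdom.mono' (by fun_prop) (Eventually.of_forall fun τ => ?_)
    have h1 : 1 ≤ 1 + U₀ * |τ| := by have := abs_nonneg τ; nlinarith
    have hpos : 0 < (1 + U₀ * |τ|) ^ 2 := by positivity
    rw [norm_mul, Complex.norm_real, Real.norm_eq_abs, ← div_eq_mul_inv, le_div_iff₀ hpos]
    have hτ : |τ| ≤ U₀⁻¹ * (1 + U₀ * |τ|) := by
      rw [mul_add, mul_one, ← mul_assoc, inv_mul_cancel₀ hU₀0.ne', one_mul]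
      have : 0 ≤ U₀⁻¹ := by positivity
      linarith
    calc |τ| * ‖psiFourier φ ψ X U₀ c τ‖ * (1 + U₀ * |τ|) ^ 2
        ≤ (U₀⁻¹ * (1 + U₀ * |τ|)) * ‖psiFourier φ ψ X U₀ c τ‖ * (1 + U₀ * |τ|) ^ 2 := by gcongr
      _ = U₀⁻¹ * ((1 + U₀ * |τ|) ^ 3 * ‖psiFourier φ ψ X U₀ c τ‖) := by ring
      _ ≤ U₀⁻¹ * C3 := mul_le_mul_of_nonneg_left (hdec τ) (by positivity)
      _ ≤ C3 * (1 + U₀⁻¹) := by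
          have : 0 ≤ C3 := (by positivity : (0:ℝ) ≤ _) |>.trans (hdec 0)
          nlinarith


/-! ### Fourier inversion: the representation of `Ψ`, and the identity `∫ ĝ_c(τ)(1/X - 2πiτ) dτ = 1` -/

/-- Fourier inversion for `g_c`: `g_c(v) = ∫ e^{2πiτv} ĝ_c(τ) dτ`. [cite: TaoTeravainen2021,
Lemma 8.2 (8.13) ("By Fourier inversion (8.12) we then have (8.13)")] -/
theorem psiTwist_eq_integral {φ ψ : ℝ → ℝ} (hφ : IsBump φ) (hψ : IsSmoothCutoff ψ) {X U₀ : ℝ}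
    (hU₀ : 1 ≤ U₀) (hX : 2 * U₀ + 2 ≤ X) {c : ℝ} (hc : c ≤ X + 1) (v : ℝ) :
    psiTwist φ ψ X U₀ c v =
      ∫ τ : ℝ, Complex.exp (↑(2 * π * (τ * v)) * Complex.I) * psiFourier φ ψ X U₀ c τ := by
  have hU₀0 : 0 < U₀ := by linarith
  have hcont := (contDiff_psiTwist hφ hψ X hU₀0 c).continuous
  have hint : Integrable (psiTwist φ ψ X U₀ c) :=
    hcont.integrable_of_hasCompactSupport (hasCompactSupport_psiTwist hφ hψ X hU₀0 c)
  have hFint : Integrable (𝓕 (psiTwist φ ψ X U₀ c)) := (integrable_psiFourier hφ hψ hU₀ hX hc).1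
  have hinv := congr_fun (hcont.fourierInv_fourier_eq hint hFint) v
  rw [Real.fourierInv_eq'] at hinv
  rw [← hinv]
  refine integral_congr_ae (ae_of_all _ fun τ => ?_)
  simp only [RCLike.inner_apply, conj_trivial, smul_eq_mul, psiFourier]
  ring_nf

/-- **The Fourier representation of `Ψ`** (our form of (8.13)): for `U₀ ≥ 1`, `2U₀ + 2 ≤ X`,
`3U₀ ≤ X`, `c ≤ X + 1` and every real `v`,
`Ψ(e^{c-v}) = e^{-v/X} ∫ e^{2πiτv} ĝ_c(τ) dτ`; at `c = log(y+h)`, `v = log d` this is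
`Φ((y+h)/d) = ∫ d^{-1/X} d^{2πiτ} ĝ_c(τ) dτ`. [cite: TaoTeravainen2021, Lemma 8.2 (8.13)] -/
theorem psiSharp_exp_sub_eq_integral {φ ψ : ℝ → ℝ} (hφ : IsBump φ) (hψ : IsSmoothCutoff ψ) {X U₀ : ℝ}
    (hU₀ : 1 ≤ U₀) (hX : 2 * U₀ + 2 ≤ X) (hX3 : 3 * U₀ ≤ X) {c : ℝ} (hc : c ≤ X + 1) (v : ℝ) :
    ((psiSharp φ ψ X U₀ (Real.exp (c - v)) : ℝ) : ℂ) =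
      Complex.exp (-(↑(X⁻¹ * v))) *
        ∫ τ : ℝ, Complex.exp (↑(2 * π * (τ * v)) * Complex.I) * psiFourier φ ψ X U₀ c τ := by
  have hU₀0 : 0 < U₀ := by linarith
  rw [psiSharp_exp_eq_psiLog φ hψ hU₀0 hX3, ← psiTwist_eq_integral hφ hψ hU₀ hX hc v]
  unfold psiTwist psiTwistR
  push_cast
  rw [← mul_assoc, ← Complex.exp_add, neg_add_cancel, Complex.exp_zero, one_mul]

/-- **The identity `∫ ĝ_c(τ) (1/X - 2πiτ) dτ = 1`** (our form of (8.16) `∫ F_j(t)(1+it) dt = 1`),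
valid once `psiLog` is the identity near `c` ("`ψ(log(x/t)/(2 log Dq²))` equals to `1` on the
support of `φ'(log((y+h_j)/t))`": in the bulk `Ψ(e^w) = w`): by Fourier inversion at `v = 0` for
`g_c` and for `g_c'` (`𝓕(g') = 2πiτ ĝ`), `∫ ĝ_c = g_c(0) = c` and `∫ 2πiτ ĝ_c(τ) dτ = g_c'(0) = c/X - 1`.
[cite: TaoTeravainen2021, Lemma 8.2 (8.16) and its proof] -/
theorem integral_psiFourier_mul_eq_one {φ ψ : ℝ → ℝ} (hφ : IsBump φ) (hψ : IsSmoothCutoff ψ) {X U₀ : ℝ}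
    (hU₀ : 1 ≤ U₀) (hX : 2 * U₀ + 2 ≤ X) {c : ℝ} (hc : c ≤ X + 1) {δ : ℝ} (hδ : 0 < δ)
    (hbulk : ∀ w ∈ Set.Ioo (c - δ) (c + δ), psiLog φ ψ X U₀ w = w) :
    ∫ τ : ℝ, psiFourier φ ψ X U₀ c τ * ((X⁻¹ : ℝ) - 2 * π * Complex.I * τ) = 1 := by
  have hU₀0 : 0 < U₀ := by linarith
  have hX0 : 0 < X := by linarith
  set g := psiTwist φ ψ X U₀ c with hg
  have hcd := contDiff_psiTwist hφ hψ X hU₀0 c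
  have hcs := hasCompactSupport_psiTwist hφ hψ X hU₀0 c
  have hcont := hcd.continuous
  have hint : Integrable g := hcont.integrable_of_hasCompactSupport hcs
  obtain ⟨hFint, hFint1⟩ := integrable_psiFourier hφ hψ hU₀ hX hc
  have hFint2 : Integrable (fun τ : ℝ => (2 * π * Complex.I * τ) * psiFourier φ ψ X U₀ c τ) :=
    (hFint1.const_mul (2 * π * Complex.I)).congr (ae_of_all _ fun τ => by simp only; ring)
  set I0 : ℂ := ∫ τ : ℝ, psiFourier φ ψ X U₀ c τ with hI0
  set I1 : ℂ := ∫ τ : ℝ, (2 * π * Complex.I * τ) * psiFourier φ ψ X U₀ c τ with hI1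
  -- `∫ ĝ = g(0)`
  have h0 : I0 = g 0 := by
    rw [hI0, hg, psiTwist_eq_integral hφ hψ hU₀ hX hc 0]
    refine integral_congr_ae (ae_of_all _ fun τ => ?_)
    simp
  -- `𝓕 g' = 2πiτ ĝ` and `∫ 𝓕 g' = g'(0)`
  have hdiff : Differentiable ℝ g := hcd.differentiable (by simp)
  have hcd' : ContDiff ℝ ∞ (deriv g) := hcd.deriv'
  have hcs' : HasCompactSupport (deriv g) := hcs.deriv
  have hint' : Integrable (deriv g) := hcd'.continuous.integrable_of_hasCompactSupport hcs'
  have hFd : 𝓕 (deriv g) = fun τ : ℝ => (2 * π * Complex.I * τ) • 𝓕 g τ := Real.fourier_deriv hint hdiff hint'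
  have hFint' : Integrable (𝓕 (deriv g)) := by
    rw [hFd]
    refine hFint1.const_mul (2 * π * Complex.I) |>.congr (ae_of_all _ fun τ => ?_)
    simp only [smul_eq_mul, psiFourier, hg]; ring
  have h1 : I1 = deriv g 0 := by
    have hinv := congr_fun (hcd'.continuous.fourierInv_fourier_eq hint' hFint') 0
    rw [Real.fourierInv_eq'] at hinv
    rw [hI1, ← hinv, hFd]
    refine integral_congr_ae (ae_of_all _ fun τ => ?_)
    simp [psiFourier, hg]
  -- evaluate `g(0) = c` and `g'(0) = c/X - 1`
  have hc0 : psiLog φ ψ X U₀ c = c := hbulk c (by rw [Set.mem_Ioo]; constructor <;> linarith)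
  have hg0 : g 0 = (c : ℂ) := by
    simp only [hg, psiTwist, psiTwistR, mul_zero, Real.exp_zero, one_mul, sub_zero, hc0]
  have hderivLog : HasDerivAt (psiLog φ ψ X U₀) 1 c := by
    have hev : psiLog φ ψ X U₀ =ᶠ[𝓝 c] id :=
      Filter.eventuallyEq_of_mem (Ioo_mem_nhds (by linarith) (by linarith)) fun w hw => hbulk w hw
    exact (hasDerivAt_id c).congr_of_eventuallyEq hev
  have hderivR : HasDerivAt (psiTwistR φ ψ X U₀ c) (X⁻¹ * c - 1) 0 := by
    have h1 : HasDerivAt (fun v => Real.exp (X⁻¹ * v)) (X⁻¹) 0 := by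
      have := ((hasDerivAt_id (0 : ℝ)).const_mul X⁻¹).exp
      simpa using this
    have h2 : HasDerivAt (fun v => psiLog φ ψ X U₀ (c - v)) (-1) 0 := by
      have h2' : HasDerivAt (psiLog φ ψ X U₀) 1 (c - (0 : ℝ)) := by simpa using hderivLog
      exact HasDerivAt.comp_const_sub c 0 h2'
    have := h1.mul h2
    simp only [mul_zero, Real.exp_zero, sub_zero, hc0, mul_neg, mul_one] at this
    unfold psiTwistR
    exact this.congr_deriv (by ring)
  have hg' : deriv g 0 = ((X⁻¹ * c - 1 : ℝ) : ℂ) := by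
    have := hderivR.ofReal_comp
    exact this.deriv
  -- combine
  have hsplit : ∫ τ : ℝ, psiFourier φ ψ X U₀ c τ * ((X⁻¹ : ℝ) - 2 * π * Complex.I * τ) = (X⁻¹ : ℝ) * I0 - I1 := by
    rw [hI0, hI1, ← integral_const_mul, ← integral_sub (hFint.const_mul _) hFint2]
    refine integral_congr_ae (ae_of_all _ fun τ => ?_); simp only; ring
  rw [hsplit, h0, h1, hg0, hg']
  push_cast
  ring


/-! ### The sieve slots: `ψ_{≤R}(e) = ∫ e^{(-1+2πiτ) log e/log R} f(τ) dτ` -/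

/-- `G(u) := e^{u} ψ(u)` (complex-valued), smooth with support in `[-1,1]`. [cite: TaoTeravainen2021,
proof of Lemma 8.2 ("`f(t) := (1/2π)∫ e^{(1+it)u}ψ(u) du` the Fourier transform of `u ↦ e^u ψ(u)`")] -/
def sieveProfile (ψ : ℝ → ℝ) : ℝ → ℂ := fun u => ((Real.exp u * ψ u : ℝ) : ℂ)

/-- **`f := 𝓕 G`** (our normalisation of the source's `f`). [cite: TaoTeravainen2021, Lemma 8.2 (8.12)] -/
def sieveFourier (ψ : ℝ → ℝ) : ℝ → ℂ := 𝓕 (sieveProfile ψ)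

/-- `G` is smooth. [folklore] -/
theorem contDiff_sieveProfile {ψ : ℝ → ℝ} (hψ : IsSmoothCutoff ψ) : ContDiff ℝ ∞ (sieveProfile ψ) :=
  ofRealCLM.contDiff.comp (Real.contDiff_exp.mul hψ.contDiff)

/-- `tsupport G ⊆ [-1, 1]`. [folklore] -/
theorem tsupport_sieveProfile_subset {ψ : ℝ → ℝ} (hψ : IsSmoothCutoff ψ) :
    tsupport (sieveProfile ψ) ⊆ Set.Icc (-1) 1 := by
  refine closure_minimal (fun u hu => ?_) isClosed_Icc
  rw [Function.mem_support] at hu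
  by_contra h
  refine hu ?_
  unfold sieveProfile
  rw [Set.mem_Icc, not_and_or, not_le, not_le] at h
  rw [hψ.eq_zero u (by rcases h with h | h <;> [rw [abs_of_neg (by linarith)]; rw [abs_of_pos (by linarith)]] <;> linarith),
    mul_zero, Complex.ofReal_zero]

/-- `G` has compact support. [folklore] -/
theorem hasCompactSupport_sieveProfile {ψ : ℝ → ℝ} (hψ : IsSmoothCutoff ψ) : HasCompactSupport (sieveProfile ψ) :=
  IsCompact.of_isClosed_subset isCompact_Icc (isClosed_tsupport _) (tsupport_sieveProfile_subset hψ)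

/-- **Decay of `f` to all orders**: `(1+|τ|)ⁿ ‖f(τ)‖ ≤ C_n(ψ)`. [cite: TaoTeravainen2021, Lemma 8.2 (8.14)] -/
theorem sieveFourier_decay {ψ : ℝ → ℝ} (hψ : IsSmoothCutoff ψ) (n : ℕ) :
    ∃ C : ℝ, 0 ≤ C ∧ ∀ τ : ℝ, (1 + |τ|) ^ n * ‖sieveFourier ψ τ‖ ≤ C := by
  have hcd := contDiff_sieveProfile hψ
  have hcs := hasCompactSupport_sieveProfile hψ
  -- uniform bounds for `G` and `G⁽ⁿ⁾`, and their `L¹` norms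
  obtain ⟨K₀, hK₀0, hK₀⟩ := Literature.NumberTheory.LFunctions.GuthMaynardFourier.exists_bound_iteratedDeriv hcd
    isCompact_Icc (tsupport_sieveProfile_subset hψ) 0
  obtain ⟨Kn, hKn0, hKn⟩ := Literature.NumberTheory.LFunctions.GuthMaynardFourier.exists_bound_iteratedDeriv hcd
    isCompact_Icc (tsupport_sieveProfile_subset hψ) n
  have hzero : ∀ k, ∀ u ∉ Set.Icc (-1 : ℝ) 1, iteratedDeriv k (sieveProfile ψ) u = 0 := fun k u hu =>
    Literature.NumberTheory.LFunctions.GuthMaynardFourier.iteratedDeriv_eq_zero_of_notMem_tsupport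
      (fun h => hu (tsupport_sieveProfile_subset hψ h)) k
  have hI0 : ∫ u, ‖sieveProfile ψ u‖ ≤ K₀ * (1 - (-1)) := by
    have := integral_norm_le_of_bound_Icc (g := iteratedDeriv 0 (sieveProfile ψ)) (by norm_num) hK₀ (hzero 0)
    simpa only [iteratedDeriv_zero] using this
  have hIn : ∫ u, ‖iteratedDeriv n (sieveProfile ψ) u‖ ≤ Kn * (1 - (-1)) :=
    integral_norm_le_of_bound_Icc (by norm_num) hKn (hzero n)
  refine ⟨2 ^ n * (2 * K₀ + 2 * Kn), by positivity, fun τ => ?_⟩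
  have h0 : ‖sieveFourier ψ τ‖ ≤ 2 * K₀ := (norm_fourier_le_integral_norm _ _).trans (by linarith)
  by_cases hτ : |τ| ≤ 1
  · calc (1 + |τ|) ^ n * ‖sieveFourier ψ τ‖ ≤ 2 ^ n * (2 * K₀) :=
          mul_le_mul (pow_le_pow_left₀ (by positivity) (by linarith) n) h0 (norm_nonneg _) (by positivity)
      _ ≤ 2 ^ n * (2 * K₀ + 2 * Kn) := by gcongr; linarith
  · push Not at hτ
    have hτ0 : τ ≠ 0 := by intro h; rw [h, abs_zero] at hτ; linarith
    have hden : 0 < (2 * π * |τ|) ^ n := by have := abs_pos.mpr hτ0; positivity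
    have hn := norm_fourier_le_of_iteratedDeriv hcd hcs n hτ0
    have h1 : (1 + |τ|) ^ n ≤ (2 * |τ|) ^ n := pow_le_pow_left₀ (by positivity) (by linarith) n
    calc (1 + |τ|) ^ n * ‖sieveFourier ψ τ‖ ≤ (2 * |τ|) ^ n * ((Kn * (1 - (-1))) / (2 * π * |τ|) ^ n) :=
          mul_le_mul h1 (hn.trans (div_le_div_of_nonneg_right hIn hden.le)) (norm_nonneg _) (by positivity)
      _ = 2 * Kn * ((2 * |τ|) ^ n / (2 * π * |τ|) ^ n) := by ring
      _ = 2 * Kn * (1 / π) ^ n := by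
          congr 1
          rw [div_eq_iff hden.ne', ← mul_pow]
          congr 1
          field_simp
      _ ≤ 2 * Kn * 1 := by
          refine mul_le_mul_of_nonneg_left (pow_le_one₀ (by positivity) ?_) (by positivity)
          rw [div_le_one Real.pi_pos]; have := Real.pi_gt_three; linarith
      _ ≤ 2 ^ n * (2 * K₀ + 2 * Kn) := by
          have : (1 : ℝ) ≤ 2 ^ n := one_le_pow₀ (by norm_num)
          nlinarith

/-- **Integrable moments of `f`**: `τ ↦ (1+|τ|)^k ‖f(τ)‖` is integrable for every `k`, and `f` is
integrable. [folklore] -/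
theorem integrable_pow_mul_norm_sieveFourier {ψ : ℝ → ℝ} (hψ : IsSmoothCutoff ψ) (k : ℕ) :
    Integrable fun τ : ℝ => (1 + |τ|) ^ k * ‖sieveFourier ψ τ‖ := by
  obtain ⟨C, hC0, hC⟩ := sieveFourier_decay hψ (k + 2)
  have hcontF : Continuous (sieveFourier ψ) :=
    VectorFourier.fourierIntegral_continuous Real.continuous_fourierChar (by exact continuous_inner)
      ((contDiff_sieveProfile hψ).continuous.integrable_of_hasCompactSupport (hasCompactSupport_sieveProfile hψ))
  have hcont : Continuous fun τ : ℝ => (1 + |τ|) ^ k * ‖sieveFourier ψ τ‖ := by fun_prop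
  have hbase : Integrable fun t : ℝ => ((1 + |t|) ^ 2)⁻¹ := by
    simpa using integrable_one_add_mul_abs_pow_neg_two one_pos
  refine (hbase.const_mul C).mono' hcont.aestronglyMeasurable (Eventually.of_forall fun τ => ?_)
  rw [Real.norm_of_nonneg (by positivity)]
  have hpos : 0 < (1 + |τ|) ^ 2 := by positivity
  rw [← div_eq_mul_inv, le_div_iff₀ hpos]
  calc (1 + |τ|) ^ k * ‖sieveFourier ψ τ‖ * (1 + |τ|) ^ 2 = (1 + |τ|) ^ (k + 2) * ‖sieveFourier ψ τ‖ := by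
        rw [pow_add]; ring
    _ ≤ C := hC τ

/-- `f` is integrable. [folklore] -/
theorem integrable_sieveFourier {ψ : ℝ → ℝ} (hψ : IsSmoothCutoff ψ) : Integrable (sieveFourier ψ) := by
  have h := integrable_pow_mul_norm_sieveFourier hψ 0
  simp only [pow_zero, one_mul] at h
  have hcontF : Continuous (sieveFourier ψ) :=
    VectorFourier.fourierIntegral_continuous Real.continuous_fourierChar (by exact continuous_inner)
      ((contDiff_sieveProfile hψ).continuous.integrable_of_hasCompactSupport (hasCompactSupport_sieveProfile hψ))
  exact (integrable_norm_iff hcontF.aestronglyMeasurable).mp h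

/-- **The Fourier representation of the cutoff** (our form of (8.12) `ψ_{≤R}(d) = ∫ d^{-(1+it)/log R} f(t) dt`):
`ψ(u) = e^{-u} ∫ e^{2πiτu} f(τ) dτ` for every real `u` (at `u = log e/log R`). [cite: TaoTeravainen2021,
Lemma 8.2 (8.12)] -/
theorem cutoff_eq_integral {ψ : ℝ → ℝ} (hψ : IsSmoothCutoff ψ) (u : ℝ) :
    ((ψ u : ℝ) : ℂ) = Complex.exp (-(u : ℂ)) * ∫ τ : ℝ, Complex.exp (↑(2 * π * (τ * u)) * Complex.I) * sieveFourier ψ τ := by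
  have hcont := (contDiff_sieveProfile hψ).continuous
  have hint : Integrable (sieveProfile ψ) := hcont.integrable_of_hasCompactSupport (hasCompactSupport_sieveProfile hψ)
  have hinv := congr_fun (hcont.fourierInv_fourier_eq hint (integrable_sieveFourier hψ)) u
  rw [Real.fourierInv_eq'] at hinv
  have hrepr : sieveProfile ψ u = ∫ τ : ℝ, Complex.exp (↑(2 * π * (τ * u)) * Complex.I) * sieveFourier ψ τ := by
    rw [← hinv]
    refine integral_congr_ae (ae_of_all _ fun τ => ?_)
    simp only [RCLike.inner_apply, conj_trivial, smul_eq_mul, sieveFourier]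
    ring_nf
  rw [← hrepr]
  unfold sieveProfile
  push_cast
  rw [← mul_assoc, ← Complex.exp_add, neg_add_cancel, Complex.exp_zero, one_mul]

/-- **`∫ f = 1`** ((8.15): "`∫_ℝ f(t) dt = e⁰ψ(0) = 1`"). [cite: TaoTeravainen2021, Lemma 8.2 (8.15)] -/
theorem integral_sieveFourier {ψ : ℝ → ℝ} (hψ : IsSmoothCutoff ψ) : ∫ τ : ℝ, sieveFourier ψ τ = 1 := by
  have h := cutoff_eq_integral hψ 0
  simp only [Complex.ofReal_zero, neg_zero, Complex.exp_zero, one_mul, mul_zero, Complex.ofReal_zero, zero_mul] at h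
  rw [hψ.eq_one 0 (by norm_num)] at h
  simpa using h.symm


end TaoTeravainen

end Literature.Barriers.Parity
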